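import Summits.RiemannHypothesis.RiemannHypothesis.Theorems.OddSectorOddArchAnchor
import HarnessLib

/-!
# Good windows below the first prime, I: the pole form and the prime part under antisymmetric
# folding (helper for crux `OddSector.OddOneSignedWindows`, item stmt-RiemannHypothesis-17778; RH-free)

Support lemmas for `Theorems/OddSectorOddOneSignedWindowsSmallWindow.lean` (every window
`0 < a`, `2a ≤ log 2` carries a real odd ground state of the FULL Weil form which is `≥ 0` on
`(0, a)`). Normalisation of `Literature/NumberTheory/LFunctions/WeilMarkovQuadratic.lean`:
`Re Q(g) = P(g) + 𝓔_a(g) − M_a‖g‖₂²` on the window `[-a, a]`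
(`weilQuadratic_re_eq_weilPoleForm_add_weilDirichletEnergy_sub`), `P = weilPoleForm` the pole form,
`𝓔_a = weilDirichletEnergy a` the pure-jump Dirichlet form, `M_a = weilMarkovConstant a`.

## Contents (everything proved)

* `weilPoleForm_eq_of_odd`: for ODD `g` the pole form is the attractive rank-one term
  `P(g) = −2|∫ g(t) sinh(t/2) dt|²` (the `cosh`-moment vanishes by parity); `weilPoleForm_const_mul`.
* `sum_weilPrimeIndex_eq_zero_of_two_mul_le_log_two`, `re_weilQuadratic_eq_of_two_mul_le_log_two`:
  below the first prime (`2a ≤ log 2`) the prime part of `𝓔_a` vanishes identically, so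
  `Re Q(f) = P(f) + ∫₀^∞ ρ D_t(f) dt − M_a‖f‖₂²` for window tests `f`.
* `weilPoleForm_fold_le`: under the smooth antisymmetric fold `h` of an odd window test `g`
  (`OddArchAnchor.exists_smooth_fold`: `|h| ≤ |g|` on `(0,∞)`, `|h − sign·|g|| ≤ 2η`) the pole form
  does not increase up to the smoothing error, `P(h) ≤ P(g) + O(η)`: pointwise
  `|g(t)||sinh(t/2)| ≤ Re(h(t) sinh(t/2)) + 2η|sinh(t/2)|` on the window, whence
  `|∫ g sinh(t/2)| ≤ ∫|g||sinh(t/2)| ≤ |∫ h sinh(t/2)| + 4aηe^a`.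

## References

* E. Bombieri, Rend. Mat. Acc. Lincei (9) 11 (2000), Thm 2 (p. 193) and §4.
* H. Yoshida, Adv. Stud. Pure Math. 21 (1992), §6 (6.2) (the pole form by parity).
-/

noncomputable section

set_option linter.dupNamespace false

open MeasureTheory Set Filter
open scoped Topology ENNReal ArithmeticFunction.vonMangoldt

namespace Summit.RiemannHypothesis.RiemannHypothesis.Theorems.OddSector

open Literature.NumberTheory.LFunctions
open Summit.RiemannHypothesis.RiemannHypothesis.Theorems.WeilGroundStateMarkovPart
open Summit.RiemannHypothesis.RiemannHypothesis.Theorems.OddArchAnchor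
open Summit.RiemannHypothesis.RiemannHypothesis.Theorems.WeilWindowFlowWindowLipschitz
open Literature.NumberTheory.LFunctions.ConnesVanSuijlekom (tendsto_integral_norm_sq)

/-! ### The pole form in the odd sector -/

/-- The `cosh(t/2)`-moment of an odd function vanishes: `∫ g(t) cosh(t/2) dt = 0`. [folklore] -/
theorem integral_mul_cosh_eq_zero_of_odd {g : ℝ → ℂ} (hgo : ∀ t, g (-t) = -g t) :
    ∫ t : ℝ, g t * (Real.cosh (t / 2) : ℂ) = 0 := by
  have h1 : ∫ t : ℝ, g (-t) * (Real.cosh (-t / 2) : ℂ) = ∫ t : ℝ, g t * (Real.cosh (t / 2) : ℂ) :=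
    integral_neg_eq_self (fun t ↦ g t * (Real.cosh (t / 2) : ℂ)) volume
  have h2 : ∫ t : ℝ, g (-t) * (Real.cosh (-t / 2) : ℂ) = -∫ t : ℝ, g t * (Real.cosh (t / 2) : ℂ) := by
    rw [← integral_neg]
    refine integral_congr_ae (Eventually.of_forall fun t ↦ ?_)
    simp only [hgo t, neg_div, Real.cosh_neg, neg_mul]
  have h3 := h1.symm.trans h2
  have h4 : (2 : ℂ) * ∫ t : ℝ, g t * (Real.cosh (t / 2) : ℂ) = 0 := by linear_combination h3
  simpa using h4

/-- **The pole form of an ODD function is the attractive rank-one term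
`P(g) = −2|∫ g(t) sinh(t/2) dt|²`** (the `cosh`-moment vanishes by parity). [folklore] -/
theorem weilPoleForm_eq_of_odd {g : ℝ → ℂ} (hgo : ∀ t, g (-t) = -g t) :
    weilPoleForm g = -2 * ‖∫ t : ℝ, g t * (Real.sinh (t / 2) : ℂ)‖ ^ 2 := by
  unfold weilPoleForm
  rw [integral_mul_cosh_eq_zero_of_odd hgo, norm_zero]
  ring

/-- Homogeneity of the pole form: `P(c · h) = |c|² P(h)`. [folklore] -/
theorem weilPoleForm_const_mul (c : ℂ) (h : ℝ → ℂ) :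
    weilPoleForm (fun x ↦ c * h x) = ‖c‖ ^ 2 * weilPoleForm h := by
  unfold weilPoleForm
  have e1 : ∫ t : ℝ, c * h t * (Real.cosh (t / 2) : ℂ) = c * ∫ t : ℝ, h t * (Real.cosh (t / 2) : ℂ) := by
    rw [← integral_const_mul]
    exact integral_congr_ae (Eventually.of_forall fun t ↦ by ring)
  have e2 : ∫ t : ℝ, c * h t * (Real.sinh (t / 2) : ℂ) = c * ∫ t : ℝ, h t * (Real.sinh (t / 2) : ℂ) := by
    rw [← integral_const_mul]
    exact integral_congr_ae (Eventually.of_forall fun t ↦ by ring)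
  rw [e1, e2, norm_mul, norm_mul, mul_pow, mul_pow]
  ring

/-- `|∫ g(t) sinh(t/2) dt| ≤ ∫ |g(t)| |sinh(t/2)| dt`. [folklore] -/
theorem norm_integral_mul_sinh_le (g : ℝ → ℂ) :
    ‖∫ t : ℝ, g t * (Real.sinh (t / 2) : ℂ)‖ ≤ ∫ t : ℝ, ‖g t‖ * |Real.sinh (t / 2)| := by
  refine (norm_integral_le_integral_norm _).trans (le_of_eq ?_)
  refine integral_congr_ae (Eventually.of_forall fun t ↦ ?_)
  simp only [norm_mul, Complex.norm_real, Real.norm_eq_abs]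

/-! ### The prime index set carries no mass below the first prime -/

/-- **Below the first prime the jump form has no prime part**: if `2a ≤ log 2` then every
`n` with `log n < 2a` is `0` or `1`, where `Λ` vanishes, so
`Σ_{log n < 2a} Λ(n) n^{-1/2} D_{log n}(f) = 0` for every `f`. [folklore] -/
theorem sum_weilPrimeIndex_eq_zero_of_two_mul_le_log_two {a : ℝ} (h2 : 2 * a ≤ Real.log 2)
    (f : ℝ → ℂ) :
    ∑ n ∈ weilPrimeIndex a, (Λ n : ℝ) / Real.sqrt n * weilIncrement f (Real.log n) = 0 := by
  refine Finset.sum_eq_zero fun n hn ↦ ?_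
  have hlog : Real.log n < Real.log 2 := (mem_weilPrimeIndex.1 hn).trans_le h2
  have hn2 : n < 2 := by
    by_contra hcon
    have h2le : (2 : ℝ) ≤ n := by exact_mod_cast (not_lt.1 hcon)
    exact absurd (Real.log_le_log two_pos h2le) (not_le.2 hlog)
  interval_cases n
  · simp
  · simp [ArithmeticFunction.vonMangoldt_apply_one]

/-- **The windowed form below the first prime.** For a test function `f` supported in `[-a, a]`
with `2a ≤ log 2`: `Re Q(f) = P(f) + ∫₀^∞ ρ(t) D_t(f) dt − M_a ∫|f|²` (Markov decomposition with
empty prime part). [cite: Bombieri2000Weil, Thm 2 (p. 193)] -/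
theorem re_weilQuadratic_eq_of_two_mul_le_log_two {a : ℝ} (h2 : 2 * a ≤ Real.log 2) {f : ℝ → ℂ}
    (hf : IsWeilTest f) (hfs : tsupport f ⊆ Icc (-a) a) :
    (weilQuadratic f).re = weilPoleForm f +
      (∫ t in Ioi (0 : ℝ), weilArchDensity t * weilIncrement f t) -
        weilMarkovConstant a * ∫ x : ℝ, ‖f x‖ ^ 2 := by
  rw [weilQuadratic_re_eq_weilPoleForm_add_weilDirichletEnergy_sub hf hfs, weilDirichletEnergy,
    sum_weilPrimeIndex_eq_zero_of_two_mul_le_log_two h2 f, zero_add]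

/-! ### Folding does not increase the pole form (up to the smoothing error) -/

/-- **The `sinh`-moment under the smooth antisymmetric fold.** If `h` is `2η`-close to
`sign · |g|` pointwise and both vanish off `[-a, a]`, then
`∫ |g| |sinh(t/2)| ≤ |∫ h sinh(t/2)| + 2η · (2a · e^a)`: pointwise
`|g(t)| |sinh(t/2)| ≤ Re (h(t) sinh(t/2)) + 2η |sinh(t/2)|` on the window. [folklore] -/
theorem integral_norm_mul_abs_sinh_le_of_fold {g h : ℝ → ℂ} {a η : ℝ} (ha : 0 < a) (hη : 0 ≤ η)
    (hg : IsWeilTest g) (hh : IsWeilTest h) (hgs : tsupport g ⊆ Icc (-a) a)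
    (hhs : tsupport h ⊆ Icc (-a) a)
    (hc : ∀ x, ‖h x - ((Real.sign x * ‖g x‖ : ℝ) : ℂ)‖ ≤ 2 * η) :
    ∫ t : ℝ, ‖g t‖ * |Real.sinh (t / 2)| ≤
      ‖∫ t : ℝ, h t * (Real.sinh (t / 2) : ℂ)‖ + 2 * η * (Real.exp a * (2 * a)) := by
  have hg0 : ∀ x, x ∉ Icc (-a) a → g x = 0 := fun x hx ↦
    image_eq_zero_of_notMem_tsupport fun h' ↦ hx (hgs h')
  have hh0 : ∀ x, x ∉ Icc (-a) a → h x = 0 := fun x hx ↦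
    image_eq_zero_of_notMem_tsupport fun h' ↦ hx (hhs h')
  -- pointwise inequality
  have hpt : ∀ t, ‖g t‖ * |Real.sinh (t / 2)| ≤
      (h t * (Real.sinh (t / 2) : ℂ)).re + (Icc (-a) a).indicator (fun _ ↦ 2 * η * Real.exp a) t := by
    intro t
    by_cases ht : t ∈ Icc (-a) a
    · rw [indicator_of_mem ht, Complex.re_mul_ofReal]
      have hsinh : |Real.sinh (t / 2)| ≤ Real.exp a := (stub_supBound_cosh_sinh_le le_rfl ht).2
      have hre : |(h t).re - Real.sign t * ‖g t‖| ≤ 2 * η := by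
        have := hc t
        calc |(h t).re - Real.sign t * ‖g t‖| = |(h t - ((Real.sign t * ‖g t‖ : ℝ) : ℂ)).re| := by
              simp only [Complex.sub_re, Complex.ofReal_re]
          _ ≤ ‖h t - ((Real.sign t * ‖g t‖ : ℝ) : ℂ)‖ := Complex.abs_re_le_norm _
          _ ≤ 2 * η := this
      rcases lt_trichotomy t 0 with h0 | h0 | h0
      · have hs : Real.sinh (t / 2) < 0 := Real.sinh_neg_iff.2 (by linarith)
        rw [Real.sign_of_neg h0, abs_of_neg hs] at *
        have h1 : (h t).re ≤ -‖g t‖ + 2 * η := by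
          have := (abs_le.1 hre).2; linarith
        nlinarith [h1, hs, hsinh, hη, norm_nonneg (g t)]
      · subst h0
        simp only [zero_div, Real.sinh_zero, abs_zero, mul_zero, zero_add]
        positivity
      · have hs : 0 < Real.sinh (t / 2) := Real.sinh_pos_iff.2 (by linarith)
        rw [Real.sign_of_pos h0, abs_of_pos hs] at *
        have h1 : ‖g t‖ - 2 * η ≤ (h t).re := by
          have := (abs_le.1 hre).1; linarith
        nlinarith [h1, hs, hsinh, hη, norm_nonneg (g t)]
    · rw [indicator_of_notMem ht, hg0 t ht, hh0 t ht]
      simp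
  -- integrate
  have hgc : Continuous g := hg.1.continuous
  have hhc' : Continuous h := hh.1.continuous
  have hgi : Integrable fun t ↦ ‖g t‖ * |Real.sinh (t / 2)| := by
    refine (Continuous.integrable_of_hasCompactSupport (by fun_prop) ?_)
    exact (hg.2.norm.mul_right (f' := fun t ↦ |Real.sinh (t / 2)|))
  have hhi : Integrable fun t ↦ h t * (Real.sinh (t / 2) : ℂ) :=
    Continuous.integrable_of_hasCompactSupport (by fun_prop) (hh.2.mul_right)
  have hIi : Integrable ((Icc (-a) a).indicator fun _ : ℝ ↦ 2 * η * Real.exp a) :=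
    (integrableOn_const (μ := volume) (s := Icc (-a) a) (C := 2 * η * Real.exp a)
      (measure_Icc_lt_top).ne).integrable_indicator measurableSet_Icc
  have hsplit : ∫ t : ℝ, ((h t * (Real.sinh (t / 2) : ℂ)).re +
      (Icc (-a) a).indicator (fun _ ↦ 2 * η * Real.exp a) t) =
      (∫ t : ℝ, (h t * (Real.sinh (t / 2) : ℂ)).re) +
        ∫ t : ℝ, (Icc (-a) a).indicator (fun _ ↦ 2 * η * Real.exp a) t :=
    integral_add hhi.re hIi
  have hre : ∫ t : ℝ, (h t * (Real.sinh (t / 2) : ℂ)).re = (∫ t : ℝ, h t * (Real.sinh (t / 2) : ℂ)).re :=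
    integral_re hhi
  calc ∫ t : ℝ, ‖g t‖ * |Real.sinh (t / 2)|
      ≤ ∫ t : ℝ, ((h t * (Real.sinh (t / 2) : ℂ)).re +
          (Icc (-a) a).indicator (fun _ ↦ 2 * η * Real.exp a) t) :=
        integral_mono hgi (hhi.re.add hIi) hpt
    _ = (∫ t : ℝ, h t * (Real.sinh (t / 2) : ℂ)).re + 2 * η * (Real.exp a * (2 * a)) := by
        rw [hsplit, hre, integral_indicator_const _ measurableSet_Icc,
          Real.volume_real_Icc_of_le (by linarith), smul_eq_mul]
        ring
    _ ≤ ‖∫ t : ℝ, h t * (Real.sinh (t / 2) : ℂ)‖ + 2 * η * (Real.exp a * (2 * a)) := by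
        linarith [Complex.re_le_norm (∫ t : ℝ, h t * (Real.sinh (t / 2) : ℂ))]

/-- The `sinh`-moment of a sub-normalised window function: if `supp h ⊆ [-a, a]` and `∫|h|² ≤ 1`
then `|∫ h sinh(t/2)| ≤ e^a √(2a)`. [folklore] -/
theorem norm_integral_mul_sinh_le_of_window {h : ℝ → ℂ} {a : ℝ} (ha : 0 < a) (hh : IsWeilTest h)
    (hhs : tsupport h ⊆ Icc (-a) a) (hn : ∫ t, ‖h t‖ ^ 2 ≤ (1 : ℝ)) :
    ‖∫ t : ℝ, h t * (Real.sinh (t / 2) : ℂ)‖ ≤ Real.exp a * Real.sqrt (2 * a) := by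
  have hh0 : ∀ x, x ∉ Icc (-a) a → h x = 0 := fun x hx ↦
    image_eq_zero_of_notMem_tsupport fun h' ↦ hx (hhs h')
  have hint : Integrable h := hh.1.continuous.integrable_of_hasCompactSupport hh.2
  have h1 := stub_supBound_norm_integral_mul_le hint hh0 (k := fun x ↦ Real.sinh (x / 2))
    (B := Real.exp a) (fun x hx ↦ (stub_supBound_cosh_sinh_le le_rfl hx).2)
  have hL1 : (∫ x, ‖h x‖) ^ 2 ≤ 2 * a := by
    have := weilNorm1_sq_le hh ha hhs
    unfold weilNorm1 weilNorm2Sq at this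
    nlinarith [this, hn, ha]
  have hL1' : ∫ x, ‖h x‖ ≤ Real.sqrt (2 * a) := by
    rw [← Real.sqrt_sq (integral_nonneg fun x ↦ norm_nonneg (h x))]
    exact Real.sqrt_le_sqrt hL1
  exact h1.trans (mul_le_mul_of_nonneg_left hL1' (Real.exp_pos a).le)

/-- **The pole form under the smooth antisymmetric fold.** For odd window tests `g`, `h` on
`[-a, a]` with `∫|g|² = 1`, `|h| ≤ |g|` on `(0, ∞)` and `|h − sign·|g|| ≤ 2η`:
`P(h) ≤ P(g) + (4 e^a √(2a) e + 2 e²)` with `e = 2η · 2a e^a` — the attractive rank-one pole term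
`−2|∫ · sinh(t/2)|²` does not increase under folding, up to the smoothing error. [folklore] -/
theorem weilPoleForm_fold_le {g h : ℝ → ℂ} {a η : ℝ} (ha : 0 < a) (hη : 0 ≤ η)
    (hg : IsWeilTest g) (hh : IsWeilTest h) (hgs : tsupport g ⊆ Icc (-a) a)
    (hhs : tsupport h ⊆ Icc (-a) a) (hgo : ∀ t, g (-t) = -g t) (hho : ∀ t, h (-t) = -h t)
    (hgn : ∫ t, ‖g t‖ ^ 2 = (1 : ℝ)) (hdom : ∀ x, 0 < x → ‖h x‖ ≤ ‖g x‖)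
    (hc : ∀ x, ‖h x - ((Real.sign x * ‖g x‖ : ℝ) : ℂ)‖ ≤ 2 * η) :
    weilPoleForm h ≤ weilPoleForm g +
      (4 * (Real.exp a * Real.sqrt (2 * a)) * (2 * η * (Real.exp a * (2 * a))) +
        2 * (2 * η * (Real.exp a * (2 * a))) ^ 2) := by
  set e : ℝ := 2 * η * (Real.exp a * (2 * a)) with he
  set C : ℝ := Real.exp a * Real.sqrt (2 * a) with hC
  set A : ℝ := ‖∫ t : ℝ, g t * (Real.sinh (t / 2) : ℂ)‖ with hA
  set B : ℝ := ‖∫ t : ℝ, h t * (Real.sinh (t / 2) : ℂ)‖ with hB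
  have he0 : 0 ≤ e := by positivity
  have hA0 : 0 ≤ A := norm_nonneg _
  have hB0 : 0 ≤ B := norm_nonneg _
  -- `A ≤ B + e`
  have hAB : A ≤ B + e :=
    (norm_integral_mul_sinh_le g).trans (integral_norm_mul_abs_sinh_le_of_fold ha hη hg hh hgs hhs hc)
  -- `B ≤ C`
  have hhn : ∫ t, ‖h t‖ ^ 2 ≤ (1 : ℝ) := by
    rw [← hgn]
    refine integral_mono_of_nonneg (Eventually.of_forall fun x ↦ by positivity)
      ((memLp_two_iff_integrable_sq_norm hg.memLp_two.1).1 hg.memLp_two)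
      (Eventually.of_forall fun x ↦ ?_)
    rcases lt_trichotomy x 0 with hx | hx | hx
    · have h1 := hdom (-x) (by linarith)
      rw [hho, hgo, norm_neg, norm_neg] at h1
      exact pow_le_pow_left₀ (norm_nonneg _) h1 2
    · subst hx
      have hg0 : g 0 = 0 := by
        have := hgo 0; rw [neg_zero] at this; exact CharZero.eq_neg_self_iff.1 this
      have hh0 : h 0 = 0 := by
        have := hho 0; rw [neg_zero] at this; exact CharZero.eq_neg_self_iff.1 this
      simp [hg0, hh0]
    · exact pow_le_pow_left₀ (norm_nonneg _) (hdom x hx) 2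
  have hBC : B ≤ C := norm_integral_mul_sinh_le_of_window ha hh hhs hhn
  rw [weilPoleForm_eq_of_odd hgo, weilPoleForm_eq_of_odd hho]
  have key : A ^ 2 ≤ B ^ 2 + 2 * B * e + e ^ 2 := by nlinarith [hAB, hA0, hB0, he0]
  nlinarith [key, hBC, he0, hB0]

end Summit.RiemannHypothesis.RiemannHypothesis.Theorems.OddSector

end
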